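import Literature.Analysis.FluidPDE.LerayFarFieldEpsilonRegularity
import Literature.Analysis.FluidPDE.LerayVelocityCubicDecay
import HarnessLib

/-!
# The Kikuchi–Seregin decay of the CKN functional: reduction to the pressure part
(Kang–Miura–Tsai 2021, Lemmas 3.3–3.4; Kikuchi–Seregin 2007, Lemma 2.2)

Analysis/FluidPDE decomposition file (D-0014 named facts) for the named fact **D**
`Literature.Analysis.FluidPDE.leray_solution_ckn_decay` (`LerayFarFieldEpsilonRegularity.lean`):
for a weakly divergence-free `u₀ ∈ L³(ℝ³)` and a local Leray solution `(v, π)` with datum `u₀`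
(`IsLocalLeraySolution 1 u₀ v π`, Kang–Miura–Tsai Def. 3.2) there are gauges
`c x₀ ∈ L^{3/2}(0, T)` (all `x₀`, all `T > 0`) with
`∫₀ᵀ ∫_{B_{3/2}(x₀)} (|v|³ + |π - c x₀ (t)|^{3/2}) → 0` as `|x₀| → ∞`, for every `T > 0`. In print
this is Kang–Miura–Tsai, IMRN 2021 = arXiv:1812.10509, Lemma 3.3 (= Kikuchi–Seregin 2007,
Lemma 2.2), the decay estimate
`‖ess sup_{0<t<T} α_R(t) + β_R(T) + γ_R^{2/3}(T) + δ_R^{4/3}(T)‖ ≤ C(T,A)(‖χ_R v₀‖²_{L²_uloc} + R^{-2/3})`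
for local energy solutions, with Lemma 3.4 (the pressure decomposition, which makes a Def. 3.2
solution a local energy solution and supplies the gauges `c_{x₀,r} ∈ L^{3/2}(0,T)`). Of the two
decaying quantities entering **D**,

* the **velocity part** `γ` (`∫₀ᵀ∫_{B_{3/2}(x₀)} |v|³ → 0`) is a theorem of the tree,
  `IsLocalLeraySolution.tendsto_lintegral_cube_cocompact` (`LerayVelocityCubicDecay.lean`, from
  the defining properties (2) and (7) of Def. 3.2 by the Sobolev inequality on balls, Lebesgue
  interpolation and Hölder in time);
* the **pressure part** `δ` genuinely needs the local pressure expansion of Lemma 3.4 /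
  Def. 3.1 (5) (`π - c_{x₀,r}(t) = π_loc + π_far` on `B_r(x₀) × (0,T)`: a near-field
  Calderón–Zygmund part `-|v|²/3 + p.v. ∫ K(x-y) : (v ⊗ v)(y) dy` over a ball of radius `2r` and
  the far-field part `∫ (K(x-y) - K(x₀-y)) : (v ⊗ v)(y) dy` over its complement,
  `K = p.v. ∇²(1/4π|x|)`) and is vendored here as the NAMED FACT `leray_solution_pressure_decay`
  (**Dp**): the statement of **D** with the velocity term removed.

Proved: `leray_solution_ckn_decay_of_pressure_decay : Dp → D` (add the velocity theorem;
`∫ (f + g) = ∫ f + ∫ g`, `0 + 0 = 0`), and the composition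
`leray_solution_farField_bound_of_pressure_decay :
lemarieRieusset_epsilon_regularity → Dp → leray_solution_farField_bound` with the tree's
`leray_solution_farField_bound_of_ckn_decay`. State of the DAG below **F**
(`leray_solution_farField_bound`) after this file: **F** ← {Lemarié-Rieusset Thm. 14.4
(`lemarieRieusset_epsilon_regularity`), **Dp**}.

Design notes. **Dp** copies the quantifier structure, the data hypotheses (`u₀ ∈ L³` weakly
divergence free, `ν = 1`), the gauge class (`MemLp (c x₀) (3/2)` on every `Ioo 0 T`), the ball
radius `3/2` (that of `δ_R`) and the filter (`cocompact ℝ³`) of the accepted **D**, so that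
`D = Dv ∧ Dp` up to splitting the integral; it is weaker than (implied by) the printed
Lemma 3.3 + Lemma 3.4 exactly as **D** is (KMT Lemma 3.3 bounds `δ_R^{4/3}(T)` separately, and
`‖χ_R v₀‖_{L²_uloc} → 0` for `v₀ ∈ L³ ⊂ E²`). Nothing is asserted: users take
`(hDp : leray_solution_pressure_decay)`.

## Mathlib / tree search

Tree: `leray_solution_ckn_decay`, `leray_solution_farField_bound_of_ckn_decay`
(`LerayFarFieldEpsilonRegularity.lean`), `IsLocalLeraySolution.tendsto_lintegral_cube_cocompact`
(`LerayVelocityCubicDecay.lean`); no pressure-expansion notion for local Leray solutions yet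
(`lean search 'pressureDecomposition|localPressure|IsLocalEnergySolution'`: none; the kernel
`pressureKernel` of `NormalisedPressure.lean` is the `K : (v ⊗ v)` density for smooth fields).
Mathlib: `lintegral_add_left'`, `Filter.Tendsto.add`.

## References

* K. Kang, H. Miura, T.-P. Tsai, *Short time regularity of Navier–Stokes flows with locally `L³`
  initial data and applications*, IMRN 2021 = arXiv:1812.10509, §3: Def. 3.1 (5), Def. 3.2,
  Lemma 3.3 (= Kikuchi–Seregin Lemma 2.2), Lemma 3.4. Bib key `KangMiuraTsai2020`.
* N. Kikuchi, G. Seregin, *Weak solutions to the Cauchy problem for the Navier–Stokes equations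
  satisfying the local energy inequality*, AMS Transl. (2) 220 (2007), Lemma 2.2, (1.3).
  Bib key `KikuchiSeregin2007`.
* Z. Bradshaw, T.-P. Tsai, Comm. PDE 45 (2020) = arXiv:1907.00256, end of §1 (the decay
  display). Bib key `BradshawTsai2020`.
-/

noncomputable section

open _root_.MeasureTheory _root_.TopologicalSpace _root_.Metric _root_.Filter _root_.Set
  _root_.Function
open scoped _root_.ENNReal _root_.NNReal _root_.Topology

namespace Literature.Analysis.FluidPDE

local notation "ℝ³" => EuclideanSpace ℝ (Fin 3)

/-! ## The named fact: decay of the gauged pressure at spatial infinity -/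

/-- NAMED FACT **Dp** (**Kikuchi–Seregin decay of the gauged pressure of a local Leray solution
at spatial infinity**; Kang–Miura–Tsai, IMRN 2021 = arXiv:1812.10509, **Lemma 3.3**
(= Kikuchi–Seregin 2007, Lemma 2.2): "A local energy solution `(v,π)` with divergence free
initial data `v₀ ∈ E²` [...] has the decay estimate
`‖ess sup_{0<t<T} α_R(t) + β_R(T) + γ_R^{2/3}(T) + δ_R^{4/3}(T)‖ ≤ C(T,A)(‖χ_R v₀‖²_{L²_uloc} + R^{-2/3})`
for any `T ∈ (0,∞)` and `R ∈ (1,∞)`", where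
`δ_R(t) = sup_{x₀ ∈ ℝ³} ∫₀ᵗ∫_{B_{3/2}(x₀)} |χ_R (p - c_{x₀})|^{3/2}`, `χ_R = 1` for `|x| > 2R`, and
`c_{x₀} ∈ L^{3/2}(0,T)` is the gauge of the pressure decomposition (Def. 3.1 (5)); with
**Lemma 3.4**: a local Leray solution in the sense of Def. 3.2 with divergence free `v₀ ∈ E²`
admits, "for any `x₀ ∈ ℝ³`, `r > 0`, and `T > 0`", the decomposition
`π = π_loc + π_far + c_{x₀,r}(t)` on `B_r(x₀) × (0,T)` "for some function
`c_{x₀,r}(t) ∈ L^{3/2}(0,T)`. In particular, `(v,π)` is a local energy solution"). Transcription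
over the tree's class, the pressure half of the accepted `leray_solution_ckn_decay`: let
`u₀ ∈ L³(ℝ³; ℝ³)` be weakly divergence free (`L³ ⊂ E²`, so `‖χ_R u₀‖_{L²_uloc} → 0`) and let
`(v, π)` be a local Leray solution of the unforced unit-viscosity equations with datum `u₀`.
Then there are gauges `c x₀ : ℝ → ℝ` (`x₀ ∈ ℝ³`), each in `L^{3/2}(0, T)` for every `T > 0`,
such that for every `T > 0`, `∫₀ᵀ ∫_{B_{3/2}(x₀)} |π - c x₀ (t)|^{3/2} dx dt → 0` as `|x₀| → ∞`
(`Filter.cocompact`). Users take `(hDp : leray_solution_pressure_decay)`.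
[cite: KangMiuraTsai2020, Lemma 3.3 (= Kikuchi–Seregin 2007 Lemma 2.2, the δ_R term) with Lemma 3.4, arXiv:1812.10509 §3 pp. 7–8] -/
def leray_solution_pressure_decay : Prop :=
  ∀ u₀ : ℝ³ → ℝ³, MemLp u₀ 3 volume → IsWeaklyDivFree u₀ →
    ∀ (v : ℝ → ℝ³ → ℝ³) (π : ℝ → ℝ³ → ℝ), IsLocalLeraySolution 1 u₀ v π →
      ∃ c : ℝ³ → ℝ → ℝ,
        (∀ (x₀ : ℝ³) (T : ℝ), 0 < T →
          MemLp (c x₀) (3 / 2 : ℝ≥0∞) (volume.restrict (Ioo 0 T))) ∧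
        ∀ T : ℝ, 0 < T →
          Tendsto (fun x₀ : ℝ³ => ∫⁻ z in Ioo 0 T ×ˢ ball x₀ (3 / 2),
              ‖π z.1 z.2 - c x₀ z.1‖ₑ ^ (3 / 2 : ℝ))
            (cocompact ℝ³) (𝓝 0)

/-! ## D from Dp and the velocity decay theorem -/

/-- **The Kikuchi–Seregin decay `leray_solution_ckn_decay` (D) from its pressure part (Dp).**
The velocity part `∫₀ᵀ∫_{B_{3/2}(x₀)} |v|³ → 0` is the theorem
`IsLocalLeraySolution.tendsto_lintegral_cube_cocompact`; the functional of **D** is the sum of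
the two (`lintegral_add_left'`), and `0 + 0 = 0` (Kang–Miura–Tsai 2021, Lemma 3.3: the terms
`γ_R` and `δ_R` of the decay estimate). [cite: KangMiuraTsai2020, Lemma 3.3 (γ_R and δ_R terms), arXiv:1812.10509 p. 7] -/
theorem leray_solution_ckn_decay_of_pressure_decay (hDp : leray_solution_pressure_decay) :
    leray_solution_ckn_decay := by
  intro u₀ h3 hdiv v π hv
  obtain ⟨c, hc, hdec⟩ := hDp u₀ h3 hdiv v π hv
  refine ⟨c, hc, fun T hT => ?_⟩
  have hv3 := hv.tendsto_lintegral_cube_cocompact (3 / 2) T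
  -- measurability of `|v|³` on the boxes
  have hvm : AEStronglyMeasurable (uncurry v) (volume.restrict (Ioi (0 : ℝ) ×ˢ univ)) :=
    hv.aestronglyMeasurable
  have hA : ∀ x₀ : ℝ³, AEMeasurable (fun z : ℝ × ℝ³ => ‖v z.1 z.2‖ₑ ^ (3 : ℕ))
      (volume.restrict (Ioo 0 T ×ˢ ball x₀ (3 / 2))) := fun x₀ =>
    (hvm.mono_measure (Measure.restrict_mono
      (Set.prod_mono Ioo_subset_Ioi_self (subset_univ _)) le_rfl)).enorm.pow_const _
  have e : (fun x₀ : ℝ³ => ∫⁻ z in Ioo 0 T ×ˢ ball x₀ (3 / 2),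
      (‖v z.1 z.2‖ₑ ^ (3 : ℕ) + ‖π z.1 z.2 - c x₀ z.1‖ₑ ^ (3 / 2 : ℝ))) =
      fun x₀ => (∫⁻ z in Ioo 0 T ×ˢ ball x₀ (3 / 2), ‖v z.1 z.2‖ₑ ^ (3 : ℕ)) +
        ∫⁻ z in Ioo 0 T ×ˢ ball x₀ (3 / 2), ‖π z.1 z.2 - c x₀ z.1‖ₑ ^ (3 / 2 : ℝ) :=
    funext fun x₀ => lintegral_add_left' (hA x₀) _
  rw [e]
  simpa using hv3.add (hdec T hT)

/-- **Far-field regularity of local Leray solutions (F) from Lemarié-Rieusset's ε-regularity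
criterion (Thm. 14.4) and the pressure decay (Dp)** — the tree's
`leray_solution_farField_bound_of_ckn_decay` with `leray_solution_ckn_decay_of_pressure_decay`
(Bradshaw–Tsai 2020, end of §1; Lemarié-Rieusset, proof of Thm. 14.5).
[cite: BradshawTsai2020, §1 p. 7 (arXiv:1907.00256, far-field regularity)] -/
theorem leray_solution_farField_bound_of_pressure_decay (hε : lemarieRieusset_epsilon_regularity)
    (hDp : leray_solution_pressure_decay) : leray_solution_farField_bound :=
  leray_solution_farField_bound_of_ckn_decay hε (leray_solution_ckn_decay_of_pressure_decay hDp)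

end Literature.Analysis.FluidPDE
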